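import Summits.CriticalPhenomena.PercolationContinuityZ3.Theorems.PercNearOneGluingNoHeavyQuantSGCLightPairPartial
import Summits.CriticalPhenomena.PercolationContinuityZ3.Theorems.PercNearOneGluingNoHeavyQuantSGCLightPairPartialLo
import Summits.CriticalPhenomena.PercolationContinuityZ3.Theorems.PercNearOneGluingNoHeavyQuantSGCLightPairRemainder
import HarnessLib

/-!
# QUANT lane R8, T-DEC, cell L2 (`LawDec.SGCLightPair`), part 4: a flow of the gated product at EVERY layer

builds on p205010 (kernel theorem, internal audit signed; external expert review pending)

Support file (`--supports stmt-CriticalPhenomena-4575`), QUANT lane seat prim-quant-arm-2 (gen 37), rung R8 of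
`run/shared/lean/prim/quant/LADDER.md`.  Theorems only, standard axioms, no sorries.  Assembles parts 1–3 (`…QuantSGCLightPairPieces`,
`…Partial`, `…Remainder`): for the law `L` with `L 0 = 1 − q`, `L t = (1−γ)[lo ≤ t]·qμ₁(t−lo) + γ[hi ≤ t]·qμ₁(t−hi)` (`t ≥ 1`), of mass `1`
and mean exactly the target `S′ = S + Δ` (`Δ ≤ 2·lo`, `y·M ≤ S′`, `y ≤ q`), and flows of `gate_q μ₁` at EVERY layer (target `S`), the law `L`
has a flow at every layer `j < M`: layers `j < lo` have the gate zero as their only low and it rides the giants (`y(1−q)/(1−y) ≤ q`); layers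
`lo ≤ j < hi` use the one-copy partial flow (`lightPair_partial_lo`) with the whole `hi`-copy as extra giant room; layers `j ≥ hi` use the
pooled two-copy partial flow (`lightPair_partial`); in both cases `flowAtT_of_partial_dichotomy` finishes, after the certified giant rooms of
the copies are located inside `Σ_{j<h≤M} L h` (`copy_giants_le`).

* `LawDec.copy_giants_le` — `c·Σ_{j−s<h′≤M₁} gate_q μ₁ h′ ≤ Σ_{j<h≤M} c·[s ≤ h]·q μ₁(h−s)` (`s ≤ j`), and the whole copy when `j < s`.
* **`LawDec.flowAtT_lightPair_layer`** — the flow of `L` at every layer `j < M`.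

[this work].  The gluing rows served [cite: KozmaNitzan2024, Conjecture 3 (p. 15)]; product measure [cite: Grimmett1999, §1.3 p. 10].
-/

noncomputable section

namespace Summit.CriticalPhenomena.PercolationContinuityZ3.Theorems

namespace Quant

open Finset

namespace LawDec

/-- **a copy's certified giant room sits inside the product's giants** (`s ≤ j`): `Σ_{j−s < h′ ≤ M₁} gate_q μ₁ h′ ≤
Σ_{j < h ≤ M} [s ≤ h]·q·μ₁(h − s)` for `μ₁ ≥ 0`, `M₁ + s ≤ M`. [this work] -/
theorem copy_giants_le (q : ℝ) (j s M₁ M : ℕ) (μ₁ : ℕ → ℝ) (hq0 : 0 ≤ q) (hμ0 : ∀ h, 0 ≤ μ₁ h) (hsj : s ≤ j) (hM : M₁ + s ≤ M) :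
    ∑ h' ∈ Finset.Ico (j - s + 1) (M₁ + 1), gate μ₁ q h'
      ≤ ∑ h ∈ Finset.Ico (j + 1) (M + 1), (if s ≤ h then q * μ₁ (h - s) else 0) := by
  have hν : ∀ h', 1 ≤ h' → gate μ₁ q h' = q * μ₁ h' := fun h' hh => by rw [gate_apply, if_neg (by omega)]; ring
  calc ∑ h' ∈ Finset.Ico (j - s + 1) (M₁ + 1), gate μ₁ q h'
      = ∑ h' ∈ Finset.Ico (j - s + 1) (M₁ + 1), q * μ₁ h' :=
        Finset.sum_congr rfl fun h' hh => hν h' (by have := (Finset.mem_Ico.1 hh).1; omega)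
    _ ≤ ∑ h' ∈ Finset.Ico (j - s + 1) (M + 1 - s), q * μ₁ h' :=
        Finset.sum_le_sum_of_subset_of_nonneg (Finset.Ico_subset_Ico le_rfl (by omega))
          (fun h' _ _ => mul_nonneg hq0 (hμ0 h'))
    _ = ∑ h' ∈ Finset.Ico (j - s + 1) (M + 1 - s), (fun h => if s ≤ h then q * μ₁ (h - s) else 0) (h' + s) :=
        Finset.sum_congr rfl fun h' _ => by simp only [if_pos (Nat.le_add_left s h'), Nat.add_sub_cancel]
    _ = ∑ h ∈ Finset.Ico (j + 1) (M + 1), (if s ≤ h then q * μ₁ (h - s) else 0) := by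
        rw [Finset.sum_Ico_add' (fun h => if s ≤ h then q * μ₁ (h - s) else 0)]
        congr 1
        congr 1 <;> omega

/-- **the whole of a copy sits on the product's giants when the layer is below its shift** (`j < s`): `q·Σ_{h′ ≤ M₁} μ₁ h′ ≤
Σ_{j < h ≤ M} [s ≤ h]·q·μ₁(h − s)`. [this work] -/
theorem copy_all_giants_le (q : ℝ) (j s M₁ M : ℕ) (μ₁ : ℕ → ℝ) (hq0 : 0 ≤ q) (hμ0 : ∀ h, 0 ≤ μ₁ h) (hjs : j < s)
    (hM : M₁ + s ≤ M) :
    q * ∑ h' ∈ Finset.range (M₁ + 1), μ₁ h' ≤ ∑ h ∈ Finset.Ico (j + 1) (M + 1), (if s ≤ h then q * μ₁ (h - s) else 0) := by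
  rw [Finset.mul_sum, Finset.range_eq_Ico]
  calc ∑ h' ∈ Finset.Ico 0 (M₁ + 1), q * μ₁ h'
      ≤ ∑ h' ∈ Finset.Ico (j + 1 - s) (M + 1 - s), q * μ₁ h' :=
        Finset.sum_le_sum_of_subset_of_nonneg (Finset.Ico_subset_Ico (by omega) (by omega))
          (fun h' _ _ => mul_nonneg hq0 (hμ0 h'))
    _ = ∑ h' ∈ Finset.Ico (j + 1 - s) (M + 1 - s), (fun h => if s ≤ h then q * μ₁ (h - s) else 0) (h' + s) :=
        Finset.sum_congr rfl fun h' _ => by simp only [if_pos (Nat.le_add_left s h'), Nat.add_sub_cancel]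
    _ = ∑ h ∈ Finset.Ico (j + 1 - s + s) (M + 1 - s + s), (if s ≤ h then q * μ₁ (h - s) else 0) :=
        Finset.sum_Ico_add' (fun h => if s ≤ h then q * μ₁ (h - s) else 0) _ _ _
    _ ≤ ∑ h ∈ Finset.Ico (j + 1) (M + 1), (if s ≤ h then q * μ₁ (h - s) else 0) :=
        Finset.sum_le_sum_of_subset_of_nonneg (Finset.Ico_subset_Ico (by omega) (by omega))
          (fun h _ _ => by split_ifs; exacts [mul_nonneg hq0 (hμ0 _), le_rfl])

/-- **A FLOW OF THE GATED PRODUCT AT EVERY LAYER.**  `0 < y < 1`, `0 < q`, `y ≤ q`, `0 ≤ γ ≤ 1`; `S > 0`, `0 ≤ Δ ≤ 2·lo`, `1 ≤ lo ≤ hi`,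
`M₁ + hi ≤ M`; `μ₁ ≥ 0` with `Σ_{h ≤ M₁} μ₁ h = 1`; flows of `gate_q μ₁` at every layer (target `S`, top `M₁`); `L ≥ 0` with `L 0 = 1 − q`,
`L t = (1−γ)[lo ≤ t]qμ₁(t−lo) + γ[hi ≤ t]qμ₁(t−hi)` for `t ≥ 1`, `Σ_{t≤M} L t = 1`, `Σ_{t ≤ M} t·L t = S + Δ`, and `y·M ≤ S + Δ`.  Then `L` has a
flow at every layer `j < M` at the target `S + Δ`. [this work] -/
theorem flowAtT_lightPair_layer (y S Δ q γ : ℝ) (j lo hi M₁ M : ℕ) (μ₁ L : ℕ → ℝ)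
    (hy0 : 0 < y) (hy1 : y < 1) (hq0 : 0 < q) (hyq : y ≤ q) (hγ0 : 0 ≤ γ) (hγ1 : γ ≤ 1) (hS : 0 < S) (hΔ0 : 0 ≤ Δ)
    (hΔlo : Δ ≤ 2 * (lo : ℝ)) (hlo : 1 ≤ lo) (hlohi : lo ≤ hi) (hM : M₁ + hi ≤ M) (hjM : j < M)
    (hμ0 : ∀ h, 0 ≤ μ₁ h) (hμ1 : ∑ h ∈ Finset.range (M₁ + 1), μ₁ h = 1)
    (hF : ∀ J, FlowAtT y S J M₁ (gate μ₁ q))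
    (hLnn : ∀ t, 0 ≤ L t) (hL0 : L 0 = 1 - q)
    (hL : ∀ t, 1 ≤ t → L t = (1 - γ) * (if lo ≤ t then q * μ₁ (t - lo) else 0) + γ * (if hi ≤ t then q * μ₁ (t - hi) else 0))
    (hL1 : ∑ t ∈ Finset.range (M + 1), L t = 1) (hLmean : ∑ t ∈ Finset.range (M + 1), (t : ℝ) * L t = S + Δ)
    (hta : y * (M : ℝ) ≤ S + Δ) :
    FlowAtT y (S + Δ) j M L := by
  classical
  have h1y : 0 < 1 - y := by linarith
  have hS' : 0 < S + Δ := by linarith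
  have huy0 : 0 < y / (1 - y) := div_pos hy0 h1y
  -- the gate zero alone fits under `q` at the giant rate
  have hzero : y / (1 - y) * (1 - q) ≤ q := by
    rw [div_mul_eq_mul_div, div_le_iff₀ h1y]; nlinarith
  -- the product's giant mass splits along the copies
  have hLgiants : ∑ h ∈ Finset.Ico (j + 1) (M + 1), L h
      = (1 - γ) * ∑ h ∈ Finset.Ico (j + 1) (M + 1), (if lo ≤ h then q * μ₁ (h - lo) else 0)
        + γ * ∑ h ∈ Finset.Ico (j + 1) (M + 1), (if hi ≤ h then q * μ₁ (h - hi) else 0) := by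
    rw [Finset.mul_sum, Finset.mul_sum, ← Finset.sum_add_distrib]
    exact Finset.sum_congr rfl fun h hh => hL h (by have := (Finset.mem_Ico.1 hh).1; omega)
  rcases Nat.lt_or_ge j lo with hjlo | hloj
  · /- ### `j < lo`: the only low is the gate zero; it rides the giants -/
    refine flowAtT_of_giants y (S + Δ) j M L hy0 hy1 hLnn ?_
    have hlow : ∑ l ∈ Finset.range (j + 1), (if 2 * (l : ℝ) < S + Δ then L l else 0) = 1 - q := by
      rw [Finset.sum_range_succ']
      simp only [Nat.cast_zero, mul_zero]
      rw [if_pos hS', hL0]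
      have : ∀ l ∈ Finset.range j, (if 2 * (((l + 1 : ℕ)) : ℝ) < S + Δ then L (l + 1) else 0) = 0 := by
        intro l hl
        rw [Finset.mem_range] at hl
        rw [hL (l + 1) (by omega), if_neg (show ¬ lo ≤ l + 1 by omega), if_neg (show ¬ hi ≤ l + 1 by omega)]
        simp
      rw [Finset.sum_eq_zero this, zero_add]
    have hgi : q ≤ ∑ h ∈ Finset.Ico (j + 1) (M + 1), L h := by
      rw [hLgiants]
      have h1 := copy_all_giants_le q j lo M₁ M μ₁ hq0.le hμ0 hjlo (by omega)
      have h2 := copy_all_giants_le q j hi M₁ M μ₁ hq0.le hμ0 (by omega) hM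
      rw [hμ1, mul_one] at h1 h2
      nlinarith
    rw [hlow]
    exact le_trans hzero hgi
  rcases Nat.lt_or_ge j hi with hjhi | hhij
  · /- ### `lo ≤ j < hi`: the `lo`-copy's partial flow; the whole `hi`-copy is giant room -/
    obtain ⟨f₁, hf₁⟩ := hF (j - lo)
    obtain ⟨φ, hφ0, hφsupp, hφz, hcolφ, hrows, hdich⟩ :=
      lightPair_partial_lo y S Δ q γ j lo hi M₁ M μ₁ L f₁ hy0 hy1 hq0 hγ1 hS hΔlo hlo hloj hjhi hjM (by omega) hμ0 hf₁ hL
    refine flowAtT_of_partial_dichotomy y (S + Δ)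
      ((1 - γ) * ∑ h ∈ Finset.Ico (j - lo + 1) (M₁ + 1), gate μ₁ q h + y / (1 - y) * (γ * (1 - q)))
      j M L φ hy0 hy1 hS' hLnn hL1 hLmean hta hjM hφ0 hφsupp hφz hcolφ hrows ?_
    rcases hdich with hfull | hplaced
    · left
      refine ⟨?_, ?_⟩
      · rw [hL0]
        have e : y / (1 - y) * ((1 - q) + ∑ t ∈ Finset.range (j + 1),
              (if (1 ≤ t ∧ t ≤ j ∧ 2 * (t : ℝ) < S + Δ) then L t - ∑ k ∈ Finset.range (M + 1), φ t k else 0))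
            = y / (1 - y) * ((1 - γ) * (1 - q) + ∑ t ∈ Finset.range (j + 1),
              (if (1 ≤ t ∧ t ≤ j ∧ 2 * (t : ℝ) < S + Δ) then L t - ∑ k ∈ Finset.range (M + 1), φ t k else 0))
              + y / (1 - y) * (γ * (1 - q)) := by ring
        rw [e]
        linarith [hfull]
      · rw [hLgiants]
        have h1 := copy_giants_le q j lo M₁ M μ₁ hq0.le hμ0 hloj (by omega)
        have h2 := copy_all_giants_le q j hi M₁ M μ₁ hq0.le hμ0 hjhi hM
        rw [hμ1, mul_one] at h2
        have h1γ : 0 ≤ 1 - γ := by linarith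
        nlinarith [mul_le_mul_of_nonneg_left h1 h1γ, mul_le_mul_of_nonneg_left h2 hγ0,
          mul_le_mul_of_nonneg_left hzero hγ0]
    · exact Or.inr hplaced
  · /- ### `hi ≤ j`: the pooled two-copy partial flow -/
    obtain ⟨f₁, hf₁⟩ := hF (j - lo)
    obtain ⟨f₂, hf₂⟩ := hF (j - hi)
    obtain ⟨φ, hφ0, hφsupp, hφz, hcolφ, hrows, hdich⟩ :=
      lightPair_partial y S Δ q γ j lo hi M₁ M μ₁ L f₁ f₂ hy0 hy1 hq0 hγ0 hγ1 hS hΔlo hlo hlohi hhij hjM hM hμ0 hf₁ hf₂ hL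
    refine flowAtT_of_partial_dichotomy y (S + Δ)
      ((1 - γ) * ∑ h ∈ Finset.Ico (j - lo + 1) (M₁ + 1), gate μ₁ q h + γ * ∑ h ∈ Finset.Ico (j - hi + 1) (M₁ + 1), gate μ₁ q h)
      j M L φ hy0 hy1 hS' hLnn hL1 hLmean hta hjM hφ0 hφsupp hφz hcolφ hrows ?_
    rcases hdich with hfull | hplaced
    · left
      refine ⟨by rw [hL0]; exact hfull, ?_⟩
      rw [hLgiants]
      have h1 := copy_giants_le q j lo M₁ M μ₁ hq0.le hμ0 hloj (by omega)
      have h2 := copy_giants_le q j hi M₁ M μ₁ hq0.le hμ0 hhij hM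
      have h1γ : 0 ≤ 1 - γ := by linarith
      nlinarith [mul_le_mul_of_nonneg_left h1 h1γ, mul_le_mul_of_nonneg_left h2 hγ0]
    · exact Or.inr hplaced

end LawDec

end Quant

end Summit.CriticalPhenomena.PercolationContinuityZ3.Theorems
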